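import Summits.MatrixMultiplication.OmegaCensus.STPPKernelListerOrderN33D
import Summits.MatrixMultiplication.OmegaCensus.STPPKernelListerFilterBridge
import Summits.MatrixMultiplication.OmegaCensus.STPPKernelListerOrderLaw32
import Summits.MatrixMultiplication.OmegaCensus.STPPKernelListerOrderN34N37

/-!
# ω-census (abelian STPP census): NO beating STPP family in any abelian group of order `33` — UNCONDITIONAL (kernel)

HONEST FRAMING (pub-omega census; verbatim): lottery ticket; floor = certified bounds/negative ranges.
Census STRUCTURE (seat pub-omega-stpp-2 gen 31, 2026-08-29), family (b2).  The conditional order capstone `volume_le_of_card_eq_33_of_dead`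
(`…OrderN33D.lean`, stpp-2 g30: dead list `deadN33 = {233_233, 233_323}`, the two survivors of the lister's own laws) with BOTH dead patterns discharged by
the tree's aligned order-three clash N20 (`STPPAlignedOrderThreeClash.lean`, `CubeNB.N20Dead 33 … = true` by `decide`, bridge `notRealizable_of_n20Dead`):
for every finite abelian group `H` of order `33` (i.e. `ℤ₃₃`) and every simultaneous-triple-product family `(Aᵢ, Bᵢ, Cᵢ)_{i<m}` of `H` (CKSU Def. 5.1; any `m`,
any sizes), `Σ |Aᵢ||Bᵢ||Cᵢ| ≤ 33`.  With `volume_le_card_of_card_le_32` and `volume_le_of_card_eq_34` this closes every order `≤ 34`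
(`volume_le_card_of_card_le_34`).  Nothing here is progress on `ω`.

References: M. Kneser, Math. Z. 58 (1953); H. Cohn, R. Kleinberg, B. Szegedy, C. Umans, FOCS 2005 (arXiv:math/0511460), Def. 5.1.
-/

open Finset

namespace Summit.MatrixMultiplication.OmegaCensus.KLister

open Literature.Computability.AlgebraicComplexity
open Summit.MatrixMultiplication.OmegaCensus.CubeNB

/-- **Order 33: no beating STPP family (kernel, unconditional, every abelian group of order 33).** [cite: CohnKleinbergSzegedyUmans2005, Def. 5.1] [cite: Kneser1953] -/
theorem volume_le_of_card_eq_33 {H : Type*} [AddCommGroup H] [Fintype H] [DecidableEq H] (hH : Fintype.card H = 33)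
    {m : ℕ} (A B C : Fin m → Finset H) (hS : IsSTPP A B C) : ∑ i, #(A i) * #(B i) * #(C i) ≤ 33 := by
  refine volume_le_of_card_eq_33_of_dead hH ?_ A B C hS
  intro D hD
  simp only [deadN33, List.mem_cons, List.not_mem_nil, or_false] at hD
  rcases hD with rfl | rfl
  · exact notRealizable_of_n20Dead hH _ (by decide)
  · exact notRealizable_of_n20Dead hH _ (by decide)

/-- **Every abelian group of order `≤ 34` admits no beating STPP family** (orders `≤ 32`: `volume_le_card_of_card_le_32`; `33`: above; `34`:
`volume_le_of_card_eq_34`). [cite: CohnKleinbergSzegedyUmans2005, Def. 5.1] -/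
theorem volume_le_card_of_card_le_34 {H : Type*} [AddCommGroup H] [Fintype H] [DecidableEq H] (hH : Fintype.card H ≤ 34)
    {m : ℕ} (A B C : Fin m → Finset H) (hS : IsSTPP A B C) : ∑ i, #(A i) * #(B i) * #(C i) ≤ Fintype.card H := by
  rcases Nat.lt_or_ge (Fintype.card H) 33 with h | h
  · exact volume_le_card_of_card_le_32 (by omega) A B C hS
  · rcases Nat.lt_or_ge (Fintype.card H) 34 with h' | h'
    · have h33 : Fintype.card H = 33 := by omega
      rw [h33]; exact volume_le_of_card_eq_33 h33 A B C hS
    · have h34 : Fintype.card H = 34 := by omega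
      rw [h34]; exact volume_le_of_card_eq_34 h34 A B C hS

end Summit.MatrixMultiplication.OmegaCensus.KLister
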